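import Summits.ValiantsHypothesis.ValiantsHypothesis.Theses.LacunarySymmetroid

/-!
# `MatrixDescartes` — negative lemmas: which hypotheses of the crux are load-bearing

Crux `stmt-ValiantsHypothesis-18050` (`Theses.LacunarySymmetroid.MatrixDescartes`, MDR):
`∀ c q, 0 < q → ∃ K₀, ∀ K m, K₀ ≤ K → m ≤ 2^((⌊log₂K⌋+c)^c) → ∀ d S (symmetric),
 Z^q ≤ 2^(K ⌊log₂K⌋)`, `Z` = number of distinct real zeros of `det (∑ₗ X^{dₗ} Sₗ)`.

One witness family drives everything here (cdisprove seat, 2026-08-17): the DIAGONAL pencil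
`X • I − diag(1, …, m)` padded with zero coefficients — `K + 2` terms, every size `m`, exactly `m`
distinct real zeros (`card_roots_SW`).  Consequences, all sorry-free:

* `matrixDescartes_false_without_sizeBound` — delete the size hypothesis `m ≤ 2^((⌊log₂K⌋+c)^c)`
  and the statement is false (`m = 2^(K⌊log₂K⌋) + 1`): any proof must use the quasi-polynomial
  size regime;
* `matrixDescartes_false_without_eventually` — replace `∃ K₀, ∀ K ≥ K₀` by `∀ K ≥ 2` and it is
  false already at `c = 2, q = 1, K = 2, m = 5` (`5 > 2^(2·1)`): the threshold `K₀` is load-bearing;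
* `matrixDescartes_false_uniform_in_c`, `matrixDescartes_false_uniform_in_q` — `K₀` cannot be chosen
  independently of `c`, nor independently of `q`: the quantifier prefix `∀ c q ∃ K₀` does not commute;
* `matrixDescartes_iff_forall_q` — the guard `0 < q` is decoration (the `q = 0` instance is `1 ≤ 2^_`);
* `exists_symm_pencil_card_roots_eq` — tightness floor: in the regime the count `Z = m` is attained,
  so `log₂ Z = (⌊log₂K⌋+c)^c` occurs for every `c`; no bound below quasi-polynomial in `K` can hold.

[folklore] Elementary (`det` of a diagonal pencil is `∏ (X − (i+1))`).
-/

-- `Summit.ValiantsHypothesis.ValiantsHypothesis.…` repeats a component by the D-0017 layout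
-- (single-conjunct summit), which the `dupNamespace` linter flags; the name is mandated.
set_option linter.dupNamespace false

namespace Summit.ValiantsHypothesis.ValiantsHypothesis.Theorems.MatrixDescartes.Negative

open Summit.ValiantsHypothesis.ValiantsHypothesis.Theses.LacunarySymmetroid
open scoped BigOperators Matrix
open Polynomial

/-! ## The diagonal witness -/

/-- exponents of the diagonal witness: `X¹` then `X⁰` everywhere (`K + 2` terms). -/
def dW (K : ℕ) : Fin (K + 2) → ℕ :=
  Fin.cons 1 fun _ => 0

/-- coefficients of the diagonal witness: `I`, `diag(−1, …, −m)`, then zero matrices. -/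
noncomputable def SW (m K : ℕ) : Fin (K + 2) → Matrix (Fin m) (Fin m) ℝ :=
  Fin.cons 1 (Fin.cons (Matrix.diagonal fun i : Fin m => -(((i : ℕ) : ℝ) + 1)) fun _ => 0)

/-- every coefficient of the witness is symmetric -/
theorem SW_isSymm (m K : ℕ) (l : Fin (K + 2)) : (SW m K l).IsSymm := by
  refine Fin.cases ?_ (fun l => ?_) l
  · simp only [SW, Fin.cons_zero]
    exact Matrix.isSymm_one
  · refine Fin.cases ?_ (fun l => ?_) l
    · simp only [SW, Fin.cons_succ, Fin.cons_zero]
      exact Matrix.isSymm_diagonal _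
    · simp only [SW, Fin.cons_succ]
      exact Matrix.isSymm_zero

/-- the witness pencil is the diagonal matrix `diag(X − 1, …, X − m)` -/
theorem pencil_SW (m K : ℕ) :
    (∑ l, (X : ℝ[X]) ^ dW K l • (SW m K l).map Polynomial.C)
      = Matrix.diagonal fun i : Fin m => X - Polynomial.C (((i : ℕ) : ℝ) + 1) := by
  rw [Fin.sum_univ_succ, Fin.sum_univ_succ]
  have h0 : ∀ x : Fin K,
      (X : ℝ[X]) ^ dW K x.succ.succ • (SW m K x.succ.succ).map Polynomial.C = 0 := by
    intro x
    simp only [SW, Fin.cons_succ, Matrix.map_zero Polynomial.C (map_zero Polynomial.C), smul_zero]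
  simp only [h0, Finset.sum_const_zero, add_zero]
  simp only [dW, SW, Fin.cons_zero, Fin.cons_succ, pow_one, pow_zero, one_smul]
  rw [Matrix.map_one Polynomial.C (map_zero _) (map_one _),
    Matrix.diagonal_map (map_zero Polynomial.C), Matrix.smul_one_eq_diagonal, Matrix.diagonal_add]
  congr 1
  funext i
  simp [sub_eq_add_neg]

/-- its determinant is `∏ᵢ (X − (i+1))` -/
theorem det_pencil_SW (m K : ℕ) :
    (∑ l, (X : ℝ[X]) ^ dW K l • (SW m K l).map Polynomial.C).det
      = ∏ i : Fin m, (X - Polynomial.C (((i : ℕ) : ℝ) + 1)) := by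
  rw [pencil_SW, Matrix.det_diagonal]

/-- the witness of size `m` has exactly `m` distinct real zeros -/
theorem card_roots_SW (m K : ℕ) :
    (∑ l, (X : ℝ[X]) ^ dW K l • (SW m K l).map Polynomial.C).det.roots.toFinset.card = m := by
  rw [det_pencil_SW]
  have hinj : Function.Injective (fun i : Fin m => ((i : ℕ) : ℝ) + 1) := by
    intro i j h
    have h' : ((i : ℕ) : ℝ) = ((j : ℕ) : ℝ) := add_right_cancel h
    exact Fin.ext (Nat.cast_injective h')
  have hprod : (∏ i : Fin m, (X - Polynomial.C (((i : ℕ) : ℝ) + 1)))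
      = ∏ a ∈ (Finset.univ.image fun i : Fin m => ((i : ℕ) : ℝ) + 1), (X - Polynomial.C a) := by
    rw [Finset.prod_image (fun x _ y _ h => hinj h)]
  rw [hprod, Polynomial.roots_prod_X_sub_C, Finset.val_toFinset,
    Finset.card_image_of_injective _ hinj, Finset.card_univ, Fintype.card_fin]

/-- **Tightness floor.** Every size `m` is attained as a distinct-real-zero count by a symmetric
lacunary pencil with any number `K + 2 ≥ 2` of terms; inside MDR's regime `m = 2^((⌊log₂K⌋+c)^c)`
this is `log₂ Z = (⌊log₂K⌋+c)^c`. [folklore] -/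
theorem exists_symm_pencil_card_roots_eq (m K : ℕ) :
    ∃ (d : Fin (K + 2) → ℕ) (S : Fin (K + 2) → Matrix (Fin m) (Fin m) ℝ),
      (∀ l, (S l).IsSymm) ∧
      (∑ l, (X : ℝ[X]) ^ d l • (S l).map Polynomial.C).det.roots.toFinset.card = m :=
  ⟨dW K, SW m K, SW_isSymm m K, card_roots_SW m K⟩

/-! ## The size hypothesis is load-bearing -/

/-- MDR with its size hypothesis `m ≤ 2 ^ ((Nat.log 2 K + c) ^ c)` deleted (the parameter `c` then
disappears). -/
def MatrixDescartesWithoutSizeBound : Prop :=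
  ∀ q : ℕ, 0 < q → ∃ K₀ : ℕ, ∀ K m : ℕ, K₀ ≤ K →
    ∀ (d : Fin K → ℕ) (S : Fin K → Matrix (Fin m) (Fin m) ℝ), (∀ l, (S l).IsSymm) →
      (Matrix.det (∑ l, ((Polynomial.X : Polynomial ℝ) ^ d l) • (S l).map Polynomial.C)
        ).roots.toFinset.card ^ q ≤ 2 ^ (K * Nat.log 2 K)

/-- **Any proof of MDR must use the size regime**: without `m ≤ 2^((⌊log₂K⌋+c)^c)` the statement
fails at `q = 1`, `K = K₀ + 2`, `m = 2^(K⌊log₂K⌋) + 1` (diagonal witness, `Z = m`). [folklore] -/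
theorem matrixDescartes_false_without_sizeBound : ¬ MatrixDescartesWithoutSizeBound := by
  intro h
  obtain ⟨K₀, hK⟩ := h 1 one_pos
  have h1 := hK (K₀ + 2) (2 ^ ((K₀ + 2) * Nat.log 2 (K₀ + 2)) + 1) (by omega) (dW K₀) (SW _ K₀)
    (SW_isSymm _ K₀)
  rw [card_roots_SW, pow_one] at h1
  omega

/-! ## The threshold `K₀` is load-bearing, and depends on both `c` and `q` -/

/-- MDR with `∃ K₀, ∀ K ≥ K₀` replaced by `∀ K ≥ 2` (the formats `K ≤ 1` are excluded on purpose: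
there `Z ≤ 1` holds, `OneTermSector`). -/
def MatrixDescartesWithoutEventually : Prop :=
  ∀ c q : ℕ, 0 < q → ∀ K m : ℕ, 2 ≤ K → m ≤ 2 ^ ((Nat.log 2 K + c) ^ c) →
    ∀ (d : Fin K → ℕ) (S : Fin K → Matrix (Fin m) (Fin m) ℝ), (∀ l, (S l).IsSymm) →
      (Matrix.det (∑ l, ((Polynomial.X : Polynomial ℝ) ^ d l) • (S l).map Polynomial.C)
        ).roots.toFinset.card ^ q ≤ 2 ^ (K * Nat.log 2 K)

/-- **The bound is genuinely asymptotic**: at `c = 2`, `q = 1`, `K = 2`, `m = 5 ≤ 2^9` the diagonal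
witness has `Z = 5 > 4 = 2^(2⌊log₂2⌋)`. [folklore] -/
theorem matrixDescartes_false_without_eventually : ¬ MatrixDescartesWithoutEventually := by
  intro h
  have hlog : Nat.log 2 (0 + 2) = 1 := Nat.log_eq_one_iff'.2 ⟨by norm_num, by norm_num⟩
  have h1 := h 2 1 one_pos (0 + 2) 5 (by norm_num) (by rw [hlog]; norm_num) (dW 0) (SW 5 0)
    (SW_isSymm 5 0)
  rw [card_roots_SW, pow_one, hlog] at h1
  norm_num at h1

/-- MDR with `K₀` chosen before `c` (uniformly in the size exponent). -/
def MatrixDescartesUniformInC : Prop :=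
  ∀ q : ℕ, 0 < q → ∃ K₀ : ℕ, ∀ c K m : ℕ, K₀ ≤ K → m ≤ 2 ^ ((Nat.log 2 K + c) ^ c) →
    ∀ (d : Fin K → ℕ) (S : Fin K → Matrix (Fin m) (Fin m) ℝ), (∀ l, (S l).IsSymm) →
      (Matrix.det (∑ l, ((Polynomial.X : Polynomial ℝ) ^ d l) • (S l).map Polynomial.C)
        ).roots.toFinset.card ^ q ≤ 2 ^ (K * Nat.log 2 K)

/-- **`K₀` must depend on `c`**: for fixed `K = K₀ + 2` the admissible size `2^((⌊log₂K⌋+c)^c)` is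
unbounded in `c`, so `m = 2^(K⌊log₂K⌋) + 1` becomes admissible (`c = K⌊log₂K⌋ + 1`) and the diagonal
witness has `Z = m`. [folklore] -/
theorem matrixDescartes_false_uniform_in_c : ¬ MatrixDescartesUniformInC := by
  intro h
  obtain ⟨K₀, hK⟩ := h 1 one_pos
  obtain ⟨E, hE⟩ : ∃ E, (K₀ + 2) * Nat.log 2 (K₀ + 2) = E := ⟨_, rfl⟩
  have hsize : 2 ^ E + 1 ≤ 2 ^ ((Nat.log 2 (K₀ + 2) + (E + 1)) ^ (E + 1)) := by
    have h1 : E + 1 ≤ (Nat.log 2 (K₀ + 2) + (E + 1)) ^ (E + 1) :=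
      calc E + 1 ≤ Nat.log 2 (K₀ + 2) + (E + 1) := Nat.le_add_left _ _
        _ ≤ (Nat.log 2 (K₀ + 2) + (E + 1)) ^ (E + 1) := Nat.le_self_pow (by omega) _
    have h2 : 1 ≤ 2 ^ E := Nat.one_le_two_pow
    calc 2 ^ E + 1 ≤ 2 ^ E + 2 ^ E := by omega
      _ = 2 ^ (E + 1) := by rw [pow_succ]; ring
      _ ≤ 2 ^ ((Nat.log 2 (K₀ + 2) + (E + 1)) ^ (E + 1)) := Nat.pow_le_pow_right (by norm_num) h1
  have h1 := hK (E + 1) (K₀ + 2) (2 ^ E + 1) (by omega) hsize (dW K₀) (SW _ K₀) (SW_isSymm _ K₀)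
  rw [card_roots_SW, pow_one, hE] at h1
  omega

/-- MDR with `K₀` chosen before `q` (uniformly in the root exponent). -/
def MatrixDescartesUniformInQ : Prop :=
  ∀ c : ℕ, ∃ K₀ : ℕ, ∀ q K m : ℕ, 0 < q → K₀ ≤ K → m ≤ 2 ^ ((Nat.log 2 K + c) ^ c) →
    ∀ (d : Fin K → ℕ) (S : Fin K → Matrix (Fin m) (Fin m) ℝ), (∀ l, (S l).IsSymm) →
      (Matrix.det (∑ l, ((Polynomial.X : Polynomial ℝ) ^ d l) • (S l).map Polynomial.C)
        ).roots.toFinset.card ^ q ≤ 2 ^ (K * Nat.log 2 K)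

/-- **`K₀` must depend on `q`**: `m = 2` is always admissible and the diagonal witness has `Z = 2`,
but `2^q ≤ 2^(K⌊log₂K⌋)` fails at `q = K⌊log₂K⌋ + 1`. [folklore] -/
theorem matrixDescartes_false_uniform_in_q : ¬ MatrixDescartesUniformInQ := by
  intro h
  obtain ⟨K₀, hK⟩ := h 0
  obtain ⟨E, hE⟩ : ∃ E, (K₀ + 2) * Nat.log 2 (K₀ + 2) = E := ⟨_, rfl⟩
  have hsize : 2 ≤ 2 ^ ((Nat.log 2 (K₀ + 2) + 0) ^ 0) := by norm_num
  have h1 := hK (E + 1) (K₀ + 2) 2 (Nat.succ_pos _) (by omega) hsize (dW K₀) (SW 2 K₀)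
    (SW_isSymm 2 K₀)
  rw [card_roots_SW, hE] at h1
  have h2 : 2 ^ (E + 1) = 2 * 2 ^ E := by rw [pow_succ]; ring
  have h3 : 1 ≤ 2 ^ E := Nat.one_le_two_pow
  omega

/-! ## The guard `0 < q` is decoration -/

/-- MDR is equivalent to the same statement for all `q` including `q = 0` (where it reads
`1 ≤ 2^_`). [folklore] -/
theorem matrixDescartes_iff_forall_q :
    MatrixDescartes ↔
      ∀ c q : ℕ, ∃ K₀ : ℕ, ∀ K m : ℕ, K₀ ≤ K → m ≤ 2 ^ ((Nat.log 2 K + c) ^ c) →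
        ∀ (d : Fin K → ℕ) (S : Fin K → Matrix (Fin m) (Fin m) ℝ), (∀ l, (S l).IsSymm) →
          (Matrix.det (∑ l, ((Polynomial.X : Polynomial ℝ) ^ d l) • (S l).map Polynomial.C)
            ).roots.toFinset.card ^ q ≤ 2 ^ (K * Nat.log 2 K) := by
  constructor
  · intro h c q
    rcases Nat.eq_zero_or_pos q with hq | hq
    · subst hq
      exact ⟨0, fun K m _ _ d S _ => by rw [pow_zero]; exact Nat.one_le_two_pow⟩
    · exact h c q hq
  · intro h c q _
    exact h c q

end Summit.ValiantsHypothesis.ValiantsHypothesis.Theorems.MatrixDescartes.Negative
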